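import Literature.NumberTheory.EllipticCurves.InertiaInvariantsKodairaNeronAdditiveProofs
import Literature.NumberTheory.EllipticCurves.TateModuleReductionRankProofs
import Literature.NumberTheory.EllipticCurves.PointDivisibilityProofs
import Literature.NumberTheory.EllipticCurves.BSDConductorSemistableProofs
import Literature.NumberTheory.EllipticCurves.HasseWeilAbelianTameNegativeJProofs
import HarnessLib

/-!
# `codim (V_ℓ E)^{I_𝔓} = 1` at the multiplicative places, from the Kodaira–Néron finiteness
# alone (Silverman *ATAEC* Thm. IV.10.2(a), multiplicative case), and the consequences

`Proofs` file (theorems only, no definitions, no named facts) in topic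
`NumberTheory/EllipticCurves`, landed by the tenured seat of bsd.S15
(`Literature.NumberTheory.EllipticCurves.conductorNorm_eq_artinConductorNat`, `BSDConductor`);
sibling of `InertiaInvariantsKodairaNeronAdditiveProofs`.  It proves the named fact
`WeierstrassCurve.codimFixed_inertia_rationalTate_eq_one_of_hasMultiplicativeReductionAt W ℓ` of
`HasseWeilAbelianConductor` — Silverman, *Advanced Topics in the Arithmetic of Elliptic Curves*,
Thm. IV.10.2(a), multiplicative case: *"`ε(E/K) = 1` if `E` has multiplicative reduction"*
(PDF p. 358 of the held copy), `codim (V_ℓ E)^{I_𝔓} = 1` — **from the Kodaira–Néron finiteness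
alone** (`WeierstrassCurve.kodairaNeron_exists_finset_reducesToNonsingular`,
`KodairaNeronUnramified`; *ATAEC* Cor. IV.9.2(d), *AEC* Cor. VII.6.2, proved in neither book),
following the printed proof (PDF p. 359, "taken from Serre–Tate [1]":
`V_ℓ(E(K^nr)) ≃ V_ℓ(E₀(K^nr)) ≃ V_ℓ(Ẽ_ns(k̄)) = V_ℓ(k̄^*) ≅ ℚ_ℓ`) with the tree's reduction of the
fact to "reduction data" at `𝔓` (`TateModuleInertiaReductionProofs`; here the variant
`codimFixed_inertia_rationalTate_eq_one_of_reduction'` of `TateModuleReductionRankProofs`, whose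
`r` need only have image containing the `ℓ`-power torsion).

The data are built inside `K̄_v` exactly as in the additive sibling (`Φ`, `W₀`, the exponent
`c` from Kodaira–Néron, `A' = F⁻¹(E₀)`); the reduction of the minimal model is now a node
(`HasMultiplicativeReduction`: `Δ ∈ 𝔪`, `c₄` a unit), `r` is the reduction to
`Ẽ_ns(k) ≅ k^×` for the residue field `k` of `\bar 𝓞_v` — surjective by Hensel over the
**henselian** valuation ring of `K̄_v` with **algebraically closed** residue field
(`exists_addMonoidHom_units_of_node_of_isAlgClosed`; `henselianRing_integer`,
`isAlgClosed_residueField_integer` of `ReductionInertiaInvarianceProofs`), and the two new inputs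
of the multiplicative case are:

* **uniquely `ℓ`-divisible kernel (`hdiv`)**: `E₁(K̄_v)` is `ℓ`-divisible
  (`exists_zsmul_eq_of_one_lt_val`, `KernelReductionDivisibleProofs`: the formal-group statement
  *AEC* IV.2.3(b)/VII.2.2 by division polynomials), an `ℓ`-division point in `E₁` of a point
  coming from `E(K̄)^{I_𝔓}` comes from `E(K̄)` (`zsmul_geomPoints_surjective_holds` and the
  algebraicity of torsion, `exists_pointsMapOfEmb_eq_of_nsmul_eq_zero`) and is again fixed by
  `I_𝔓`: an element of `I_𝔓` lifts to `I_𝔐` (`exists_mem_inertia_apply_eq_holds`, Neukirch II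
  (9.6)), which preserves `E₁` (isometry, `reducesToZero_congrEquiv_map_iff`), and two
  `ℓ`-division points of the same point lying in `E₁` coincide (`E₁[ℓ] = 0`, *AEC* VII.3.1(a));
* **image ⊇ `ℓ`-power torsion (`hr`)**: a preimage `P₀ ∈ E₀(K̄_v)` of an `ℓ`-power root of unity is
  corrected by an `ℓⁿ`-division point of `ℓⁿP₀ ∈ E₁` to a torsion point of `E₀(K̄_v)`, which comes
  from `E(K̄)[ℓⁿ]` and is fixed by `I_𝔓` because inertia does not move reductions
  (`reducePoint_congrEquiv_map_eq`) and reduction is injective on the prime-to-`p` torsion of `E₀`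
  (`eq_of_reducePoint_eq_of_zsmul_eq_zero`, *AEC* VII.3.1(b)).

## Main results

* `WeierstrassCurve.codimFixed_inertia_rationalTate_eq_one_of_hasMultiplicativeReductionAt_of_kodairaNeron_primeBelow`,
  `…_at`, and **`…_of_kodairaNeron : (∀ v, Kodaira–Néron at v) → the named fact `hTm`**;
* consequences with the additive sibling: **Thm. IV.10.2(a) in full**
  (`codimFixed_inertia_rationalTate_eq_tameConductorExponent_of_kodairaNeron`), **Thm. IV.10.2(b)
  at the multiplicative places** (`swanConductorAt_rationalTate_eq_zero_of_hasMultiplicativeReductionAt_of_kodairaNeron`),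
  the C15 fact for semistable curves
  (`artinConductorExponent_tate_eq_conductorExponent_of_isSemistable_of_kodairaNeron`) — whence
  also the criterion of Néron–Ogg–Shafarevich by `neronOggShafarevich_of_codimFixed_facts`
  (`NeronOggShafarevichProofs`, fed with the two `…_of_kodairaNeron` theorems; not restated here)
  — and over `ℚ` **bsd.S15**
  (`Literature.NumberTheory.EllipticCurves.conductorNorm_eq_artinConductorNat_of_isSemistable_of_kodairaNeron`
  for semistable `E/ℚ` from Kodaira–Néron alone;
  `conductorNorm_eq_artinConductorNat_of_kodairaNeron_of_ringChar_eq` in general from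
  Kodaira–Néron for the curves over `ℚ` and Ogg–Saito at `p = 2, 3`).

So after this file the trust base of bsd.S15 for an elliptic `E/ℚ` is
{Kodaira–Néron finiteness (*ATAEC* IV.9.2(d)), Ogg–Saito at `p = 2, 3` (*ATAEC* 11.1 via Ogg's
`p = 3` pages and Saito)}, and for a semistable `E/ℚ` Kodaira–Néron alone.

All axioms `propext`, `Classical.choice`, `Quot.sound`.

## References

* J. H. Silverman, *Advanced Topics in the Arithmetic of Elliptic Curves*, GTM 151 (1994), §IV.10,
  Thm. 10.2 and its proof (PDF pp. 358–359); Cor. IV.9.2(d); §IV.11. [SilvermanATAEC1994]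
* J.-P. Serre, J. Tate, *Good reduction of abelian varieties*, Ann. of Math. 88 (1968), §1,
  Lemmas 1–2; Thm. 1. [SerreTate1968]
* J. H. Silverman, *The Arithmetic of Elliptic Curves*, 2nd ed. (2009), VII.2.1, VII.2.2,
  VII.3.1, VII.5.1(b), Cor. VII.6.2, Thm. VII.7.1. [SilvermanAEC2009]
* J. Neukirch, *Algebraic Number Theory* (1999), Ch. II §9 (9.3), (9.6). [NeukirchANT1999]

## Design

No definitions; `noncomputable section`; `open scoped Classical NNReal Pointwise`; one universe
`u`.  `set_option maxHeartbeats 800000` for the main proof (long, many coercions).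
-/

noncomputable section

open scoped Classical NNReal Pointwise
open NumberField IsDedekindDomain

universe u

namespace WeierstrassCurve

open Literature.NumberTheory.EllipticCurves Literature.NumberTheory.GaloisRepresentations Field
  IsDedekindDomain.HeightOneSpectrum

variable {K : Type u} [Field K] [NumberField K] {v : HeightOneSpectrum (𝓞 K)}
  (W : WeierstrassCurve K) (ℓ : ℕ) [Fact ℓ.Prime]

set_option maxHeartbeats 800000 in
/-- **Silverman *ATAEC* Thm. IV.10.2(a), multiplicative case, from Kodaira–Néron — at the
prime cut out by an embedding.**  For an elliptic curve `E/K` over a number field, a prime `ℓ`, a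
place `v ∤ ℓ` of multiplicative reduction, a `K`-embedding `ι : K̄ → K̄_v` and the prime `𝔐` of
`\\bar 𝓞_v` above `𝓂_v`: granted Kodaira–Néron for the minimal model at `v`,
`codim (V_ℓ E)^{I_{𝔓_{ι,𝔐}}} = 1`.  Proof in the module docstring.
[cite: SilvermanATAEC1994, Thm. IV.10.2(a), multiplicative case, and its proof (PDF pp. 358–359)]
[cite: SerreTate1968, §1 Lemma 2] -/
theorem codimFixed_inertia_rationalTate_eq_one_of_hasMultiplicativeReductionAt_of_kodairaNeron_primeBelow
    [W.IsElliptic]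
    (hKN : (W.localMinimalModel v).kodairaNeron_exists_finset_reducesToNonsingular)
    (h : Continuous fun x : absoluteGaloisGroup K × RationalTateModule (geomPoints W) ℓ ↦
      rationalTateRepresentation (absoluteGaloisGroup K) (geomPoints W) ℓ x.1 x.2)
    (hℓ : (ℓ : 𝓞 K) ∉ v.asIdeal) (hmult : W.HasMultiplicativeReductionAt v)
    (ι : AlgebraicClosure K →ₐ[K] AlgebraicClosure (v.adicCompletion K))
    {𝔐 : Ideal v.localAbsIntegers} (h𝔐 : 𝔐 ∈ v.localPrimesAbove) :
    (rationalTateGaloisRepOf (geomPoints W) ℓ h).codimFixed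
      ((v.primeBelow ι 𝔐).inertia (absoluteGaloisGroup K)) = 1 := by
  obtain ⟨w, hw⟩ := v.exists_spectralValuation
  have hv0 : w.Integers w.integer := Valuation.integer.integers w
  haveI := henselianRing_integer w
  haveI := isAlgClosed_residueField_integer w
  -- models
  haveI : (W.localMinimalModel v).IsElliptic := W.isElliptic_localMinimalModel v
  have hint : ((W.localMinimalModel v).baseChange (AlgebraicClosure (v.adicCompletion K))).IsIntegral
      w.integer := by
    have := isIntegral_spectralValuation_baseChange hw
      ((W.localMinimalModel v).integralModel (v.adicCompletionIntegers K))
    rwa [show ((W.localMinimalModel v).integralModel (v.adicCompletionIntegers K)).map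
        (algebraMap (v.adicCompletionIntegers K) (v.adicCompletion K)) = W.localMinimalModel v from
      baseChange_integralModel_eq (v.adicCompletionIntegers K) (W.localMinimalModel v)] at this
  haveI := hint
  obtain ⟨W₀, hW₀⟩ := hint.integral
  -- the reduction of `W₀` is a node
  have hΔeq : algebraMap w.integer (AlgebraicClosure (v.adicCompletion K)) W₀.Δ =
      algebraMap (v.adicCompletion K) (AlgebraicClosure (v.adicCompletion K))
        (algebraMap (v.adicCompletionIntegers K) (v.adicCompletion K)
          ((W.localMinimalModel v).integralModel (v.adicCompletionIntegers K)).Δ) := by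
    rw [integralModel_Δ_eq, ← map_Δ, ← map_Δ]
    change (W₀.baseChange (AlgebraicClosure (v.adicCompletion K))).Δ =
      ((W.localMinimalModel v).baseChange (AlgebraicClosure (v.adicCompletion K))).Δ
    rw [hW₀]
  have hc₄eq : algebraMap w.integer (AlgebraicClosure (v.adicCompletion K)) W₀.c₄ =
      algebraMap (v.adicCompletion K) (AlgebraicClosure (v.adicCompletion K))
        (algebraMap (v.adicCompletionIntegers K) (v.adicCompletion K)
          ((W.localMinimalModel v).integralModel (v.adicCompletionIntegers K)).c₄) := by
    rw [integralModel_c₄_eq, ← map_c₄, ← map_c₄]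
    change (W₀.baseChange (AlgebraicClosure (v.adicCompletion K))).c₄ =
      ((W.localMinimalModel v).baseChange (AlgebraicClosure (v.adicCompletion K))).c₄
    rw [hW₀]
  have hΔ : IsLocalRing.residue w.integer W₀.Δ = 0 := by
    have hlt := (show (W.localMinimalModel v).HasMultiplicativeReduction
      (v.adicCompletionIntegers K) from hmult).badReduction
    rw [← integralModel_Δ_eq (v.adicCompletionIntegers K) (W.localMinimalModel v)] at hlt
    have hmem := (IsDedekindDomain.HeightOneSpectrum.valuation_lt_one_iff_mem _ _).mp hlt
    rw [← v_algebraMap_lt_one_iff hv0, hΔeq]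
    exact spectralValuation_algebraMap_lt_one_of_mem_maximalIdeal hw h𝔐 hmem
  have hc₄ : IsLocalRing.residue w.integer W₀.c₄ ≠ 0 := by
    have heq := (show (W.localMinimalModel v).HasMultiplicativeReduction
      (v.adicCompletionIntegers K) from hmult).multiplicativeReduction
    rw [← integralModel_c₄_eq (v.adicCompletionIntegers K) (W.localMinimalModel v)] at heq
    have hnot : ((W.localMinimalModel v).integralModel (v.adicCompletionIntegers K)).c₄ ∉
        IsLocalRing.maximalIdeal (v.adicCompletionIntegers K) := fun hmem ↦ by
      have := (IsDedekindDomain.HeightOneSpectrum.valuation_lt_one_iff_mem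
        (K := v.adicCompletion K)
        (IsDiscreteValuationRing.maximalIdeal (v.adicCompletionIntegers K)) _).mpr hmem
      rw [heq] at this
      exact lt_irrefl _ this
    have hunit : IsUnit ((W.localMinimalModel v).integralModel (v.adicCompletionIntegers K)).c₄ := by
      by_contra hu
      exact hnot ((IsLocalRing.mem_maximalIdeal _).mpr hu)
    rw [← v_algebraMap_eq_one_iff hv0, hc₄eq]
    exact spectralValuation_eq_one_of_isUnit hw hunit
  obtain ⟨rn, hrn_surj, hrn⟩ := W₀.exists_addMonoidHom_units_of_node_of_isAlgClosed hv0 hΔ hc₄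
  -- transport and the Kodaira–Néron exponent
  obtain ⟨C, hC⟩ := W.exists_variableChange_smul_eq_localMinimalModel v
  obtain ⟨Φ, hΦ⟩ := W.exists_addEquiv_localPoints_of_smul_eq v hC
  obtain ⟨c, hc, hcE₀⟩ := exists_nsmul_hasNonsingularReduction_of_kodairaNeron hKN hw h𝔐 hW₀
  set H := (v.primeBelow ι 𝔐).inertia (absoluteGaloisGroup K) with hH
  let F : FixedPoints.addSubgroup H (geomPoints W) →+
      (W₀.baseChange (AlgebraicClosure (v.adicCompletion K))).toAffine.Point :=
    (Affine.Point.congrEquiv hW₀).toAddMonoidHom.comp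
      (Φ.toAddMonoidHom.comp ((pointsMapOfEmb W ι).comp
        (FixedPoints.addSubgroup H (geomPoints W)).subtype))
  have hFapply : ∀ P : FixedPoints.addSubgroup H (geomPoints W),
      F P = Affine.Point.congrEquiv hW₀ (Φ (pointsMapOfEmb W ι (P : geomPoints W))) := fun _ ↦ rfl
  have hFinj : Function.Injective F := fun P Q hPQ ↦ by
    rw [hFapply, hFapply] at hPQ
    exact Subtype.ext (pointsMapOfEmb_injective W ι (Φ.injective
      ((Affine.Point.congrEquiv hW₀).injective hPQ)))
  -- local inertia lifts / restricts
  have hfixloc : ∀ P : FixedPoints.addSubgroup H (geomPoints W),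
      ∀ σ ∈ 𝔐.inertia (absoluteGaloisGroup (v.adicCompletion K)),
        Affine.Point.map ((absoluteGaloisGroup.toAlgEquiv _ σ :
            AlgebraicClosure (v.adicCompletion K) ≃ₐ[v.adicCompletion K]
              AlgebraicClosure (v.adicCompletion K)) :
            AlgebraicClosure (v.adicCompletion K) →ₐ[v.adicCompletion K]
              AlgebraicClosure (v.adicCompletion K)) (Φ (pointsMapOfEmb W ι (P : geomPoints W))) =
          Φ (pointsMapOfEmb W ι (P : geomPoints W)) := by
    intro P σ hσ
    rw [← hΦ σ, ← pointsMapOfEmb_smul]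
    congr 2
    exact P.2 ⟨_, resGalOfEmb_mem_inertia_primeBelow v ι 𝔐 hσ⟩
  let A' : AddSubgroup (FixedPoints.addSubgroup H (geomPoints W)) :=
    (W₀.nonsingularReductionSubgroup hv0).comap F
  have hA'mem : ∀ P, P ∈ A' ↔ W₀.HasNonsingularReduction (F P) := fun _ ↦ Iff.rfl
  have hA' : ∀ P : FixedPoints.addSubgroup H (geomPoints W), c • P ∈ A' := by
    intro P
    rw [hA'mem, map_nsmul, hFapply, ← map_nsmul]
    exact hcE₀ _ (hfixloc P)
  let F' : A' →+ W₀.nonsingularReductionSubgroup hv0 :=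
    (F.comp A'.subtype).codRestrict _ (fun P ↦ P.2)
  have hF'coe : ∀ P : A', (F' P : (W₀.baseChange (AlgebraicClosure (v.adicCompletion K))).toAffine.Point)
      = F P := fun _ ↦ rfl
  let r : A' →+ Additive (IsLocalRing.ResidueField w.integer)ˣ := rn.comp F'
  have hrapply : ∀ P : A', r P = rn (F' P) := fun _ ↦ rfl
  have hℓw : w ((ℓ : ℤ) : AlgebraicClosure (v.adicCompletion K)) = 1 :=
    spectralValuation_intCast_eq_one hw (n := (ℓ : ℤ)) (by simpa using hℓ)
  have hℓnw : ∀ n : ℕ, w (((ℓ ^ n : ℕ) : ℤ) : AlgebraicClosure (v.adicCompletion K)) = 1 := fun n ↦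
    spectralValuation_intCast_eq_one hw (n := ((ℓ ^ n : ℕ) : ℤ))
      (by simpa using v.natCast_pow_not_mem hℓ n)
  have htf : ∀ P : A', r P = 0 → ℓ • P = 0 → P = 0 := by
    intro P hr0 hℓP
    have h0 : W₀.ReducesToZero (F P) := (hrn (F' P)).mp hr0
    have hℓF : (ℓ : ℤ) • F P = 0 := by
      rw [natCast_zsmul, ← map_nsmul, ← AddSubgroup.coe_nsmul, hℓP, AddSubgroup.coe_zero, map_zero]
    have hF0 : F P = 0 := h0.eq_zero_of_zsmul_eq_zero W₀ hℓw hℓF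
    have hP0 : (P : FixedPoints.addSubgroup H (geomPoints W)) = 0 := hFinj (by rw [hF0, map_zero])
    exact Subtype.ext hP0
  have hℓk : ((ℓ : ℕ) : IsLocalRing.ResidueField w.integer) ≠ 0 := by
    have hℓw' : w (algebraMap w.integer (AlgebraicClosure (v.adicCompletion K)) (ℓ : w.integer)) = 1 := by
      rw [map_natCast]; exact_mod_cast hℓw
    have h1 : IsLocalRing.residue w.integer (ℓ : w.integer) ≠ 0 :=
      (v_algebraMap_eq_one_iff hv0 _).mp hℓw'
    simpa using h1
  -- inertia elements of `Γ_K` at `𝔓_{ι,𝔐}` lift to `I_𝔐` (Neukirch II (9.6))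
  have hlift : ∀ {σ : absoluteGaloisGroup K}, σ ∈ H →
      ∃ τ ∈ 𝔐.inertia (absoluteGaloisGroup (v.adicCompletion K)), resGalOfEmb ι τ = σ := by
    intro σ hσ
    obtain ⟨τ, hτI, hτ⟩ := exists_mem_inertia_apply_eq_holds v ι h𝔐 hσ
    exact ⟨τ, hτI, resGalOfEmb_eq_of_apply_eq ι hτ⟩
  -- two points of `E₁`, resp. of `E₀` killed by `ℓ^n`, with ... : a point of `X(K̄_v)` in `E₁`
  -- (resp. torsion in `E₀`) whose `ℓ`-multiple (resp. reduction) is `I_𝔐`-invariant is `I_𝔐`-fixed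
  -- **hdiv**
  have hdiv : ∀ P : A', r P = 0 → ∃ Q : A', r Q = 0 ∧ ℓ • Q = P := by
    intro P hr0
    have h0 : W₀.ReducesToZero (F P) := (hrn (F' P)).mp hr0
    -- name the geometric point under `P`
    set Pg : geomPoints W := ((P : FixedPoints.addSubgroup H (geomPoints W)) : geomPoints W) with hPg
    have hPgfix : ∀ σ ∈ H, σ • Pg = Pg := fun σ hσ ↦ (P : FixedPoints.addSubgroup H (geomPoints W)).2 ⟨σ, hσ⟩
    have hFP : F P = Affine.Point.congrEquiv hW₀ (Φ (pointsMapOfEmb W ι Pg)) := hFapply _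
    rcases hR : Φ (pointsMapOfEmb W ι Pg) with _ | ⟨x, y, hxy⟩
    · -- `P = 0`
      refine ⟨0, map_zero r, ?_⟩
      have hF0 : F P = 0 := by
        rw [hFP, hR, ← Affine.Point.zero_def, map_zero]
      have hP0 : (P : FixedPoints.addSubgroup H (geomPoints W)) = 0 := hFinj (by rw [hF0, map_zero])
      rw [smul_zero]
      exact (Subtype.ext hP0).symm
    · -- `Φ ι_* P = (x, y)` with `w x > 1`
      have hx : 1 < w x := by
        rw [hFP, hR, Affine.Point.congrEquiv_some, reducesToZero_some_iff, not_mem_range_iff hv0] at h0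
        exact h0
      obtain ⟨x', y', hxy', hx', hdivpt⟩ := exists_zsmul_eq_of_one_lt_val (w := w)
        (V := (W.localMinimalModel v).baseChange (AlgebraicClosure (v.adicCompletion K)))
        (m := (ℓ : ℤ)) hℓw hxy hx
      set R' : ((W.localMinimalModel v).baseChange (AlgebraicClosure (v.adicCompletion K))).toAffine.Point :=
        .some x' y' hxy' with hR'
      have hR'E₁ : W₀.ReducesToZero (Affine.Point.congrEquiv hW₀ R') := by
        rw [hR', Affine.Point.congrEquiv_some, reducesToZero_some_iff, not_mem_range_iff hv0]
        exact hx'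
      have hℓR' : (ℓ : ℤ) • R' = Φ (pointsMapOfEmb W ι Pg) := by rw [hR', hdivpt, hR]
      -- lift `R'` to `E(K̄)`
      obtain ⟨Q₀, hQ₀⟩ := W.zsmul_geomPoints_surjective_holds (n := (ℓ : ℤ))
        (by exact_mod_cast (Fact.out : ℓ.Prime).ne_zero) Pg
      have hQ₀' : (ℓ : ℤ) • Q₀ = Pg := hQ₀
      have htors : ℓ • (Φ.symm R' - pointsMapOfEmb W ι Q₀) = 0 := by
        rw [nsmul_sub, ← natCast_zsmul, ← natCast_zsmul, ← map_zsmul, hℓR',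
          AddEquiv.symm_apply_apply, ← map_zsmul, hQ₀', sub_self]
      obtain ⟨T₀, -, hT₀⟩ := exists_pointsMapOfEmb_eq_of_nsmul_eq_zero W ι
        (Fact.out : ℓ.Prime).ne_zero htors
      set Q' : geomPoints W := Q₀ + T₀ with hQ'
      have hιQ' : pointsMapOfEmb W ι Q' = Φ.symm R' := by
        rw [hQ', map_add, hT₀]; abel
      have hΦιQ' : Φ (pointsMapOfEmb W ι Q') = R' := by rw [hιQ', AddEquiv.apply_symm_apply]
      -- `Q'` is fixed by `I_𝔓`
      have hQ'fix : ∀ σ ∈ H, σ • Q' = Q' := by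
        intro σ hσ
        obtain ⟨τ, hτI, hres⟩ := hlift hσ
        obtain ⟨hτ₁, -⟩ := isometry_of_mem_inertia hw h𝔐 hτI
        apply pointsMapOfEmb_injective W ι
        rw [← hres, pointsMapOfEmb_smul, hιQ']
        apply Φ.injective
        rw [hΦ τ, AddEquiv.apply_symm_apply]
        -- both sides are `ℓ`-division points of `Φ ι_* P` lying in `E₁`
        have hτR'E₁ : W₀.ReducesToZero (Affine.Point.congrEquiv hW₀ (Affine.Point.map
            ((absoluteGaloisGroup.toAlgEquiv _ τ :
              AlgebraicClosure (v.adicCompletion K) ≃ₐ[v.adicCompletion K]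
                AlgebraicClosure (v.adicCompletion K)) :
              AlgebraicClosure (v.adicCompletion K) →ₐ[v.adicCompletion K]
                AlgebraicClosure (v.adicCompletion K)) R')) :=
          (W₀.reducesToZero_congrEquiv_map_iff hW₀ _ hτ₁ R').mpr hR'E₁
        have hℓτR' : (ℓ : ℤ) • Affine.Point.map ((absoluteGaloisGroup.toAlgEquiv _ τ :
              AlgebraicClosure (v.adicCompletion K) ≃ₐ[v.adicCompletion K]
                AlgebraicClosure (v.adicCompletion K)) :
              AlgebraicClosure (v.adicCompletion K) →ₐ[v.adicCompletion K]
                AlgebraicClosure (v.adicCompletion K)) R' = Φ (pointsMapOfEmb W ι Pg) := by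
          rw [← map_zsmul, hℓR', ← hΦ τ, ← pointsMapOfEmb_smul, hres, hPgfix σ hσ]
        have hdiff := (W₀.kernelOfReduction hv0).sub_mem hτR'E₁ hR'E₁
        rw [mem_kernelOfReduction_iff, ← map_sub] at hdiff
        have hℓdiff : (ℓ : ℤ) • Affine.Point.congrEquiv hW₀ (Affine.Point.map
            ((absoluteGaloisGroup.toAlgEquiv _ τ :
              AlgebraicClosure (v.adicCompletion K) ≃ₐ[v.adicCompletion K]
                AlgebraicClosure (v.adicCompletion K)) :
              AlgebraicClosure (v.adicCompletion K) →ₐ[v.adicCompletion K]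
                AlgebraicClosure (v.adicCompletion K)) R' - R') = 0 := by
          rw [← map_zsmul, smul_sub, hℓτR', hℓR', sub_self, map_zero]
        have hzero := hdiff.eq_zero_of_zsmul_eq_zero W₀ hℓw hℓdiff
        rw [map_sub, sub_eq_zero] at hzero
        exact (Affine.Point.congrEquiv hW₀).injective hzero
      have hQ'mem : Q' ∈ FixedPoints.addSubgroup H (geomPoints W) := fun m ↦ hQ'fix m m.2
      have hFQ' : F ⟨Q', hQ'mem⟩ = Affine.Point.congrEquiv hW₀ R' := by
        rw [hFapply]
        exact congrArg _ hΦιQ'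
      have hQ'A' : (⟨Q', hQ'mem⟩ : FixedPoints.addSubgroup H (geomPoints W)) ∈ A' := by
        rw [hA'mem, hFQ']
        exact hR'E₁.hasNonsingularReduction
      refine ⟨⟨_, hQ'A'⟩, ?_, ?_⟩
      · rw [hrapply]
        exact (hrn _).mpr (by rw [hF'coe]; change W₀.ReducesToZero (F ⟨Q', hQ'mem⟩); rw [hFQ']; exact hR'E₁)
      · apply Subtype.ext
        apply Subtype.ext
        change ℓ • Q' = Pg
        apply pointsMapOfEmb_injective W ι
        rw [map_nsmul, hιQ', ← map_nsmul, ← natCast_zsmul, hℓR', AddEquiv.symm_apply_apply]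
  -- **hr**: the image of `r` contains the `ℓ`-power torsion
  have hr : ∀ b : Additive (IsLocalRing.ResidueField w.integer)ˣ, ∀ n : ℕ, ℓ ^ n • b = 0 →
      b ∈ r.range := by
    intro b n hb
    obtain ⟨P₀, hP₀⟩ := hrn_surj b
    set S₀ := (Affine.Point.congrEquiv hW₀).symm
      (P₀ : (W₀.baseChange (AlgebraicClosure (v.adicCompletion K))).toAffine.Point) with hS₀
    have hcS₀ : Affine.Point.congrEquiv hW₀ S₀ = P₀ := by rw [hS₀, AddEquiv.apply_symm_apply]
    have hS₀E₀ : W₀.HasNonsingularReduction (Affine.Point.congrEquiv hW₀ S₀) := by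
      rw [hcS₀]; exact P₀.2
    -- `ℓ^n • S₀ ∈ E₁`
    have hker : W₀.ReducesToZero (Affine.Point.congrEquiv hW₀ ((ℓ ^ n : ℕ) • S₀)) := by
      have h1 : rn ((ℓ ^ n : ℕ) • P₀) = 0 := by rw [map_nsmul, hP₀, hb]
      have h2 := (hrn _).mp h1
      rwa [AddSubgroup.coe_nsmul, ← hcS₀, ← map_nsmul] at h2
    -- a torsion point `P₁ ∈ E₀` with `rn`-image `b`
    obtain ⟨P₁, hP₁E₀, hP₁tors, hP₁img⟩ :
        ∃ P₁ : ((W.localMinimalModel v).baseChange (AlgebraicClosure (v.adicCompletion K))).toAffine.Point,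
          ∃ hE₀ : W₀.HasNonsingularReduction (Affine.Point.congrEquiv hW₀ P₁),
            (ℓ ^ n : ℕ) • P₁ = 0 ∧ rn ⟨Affine.Point.congrEquiv hW₀ P₁, hE₀⟩ = b := by
      rcases hT : ((ℓ ^ n : ℕ) • S₀) with _ | ⟨x, y, hxy⟩
      · refine ⟨S₀, hS₀E₀, by rw [hT, Affine.Point.zero_def], ?_⟩
        rw [← hP₀]; congr 1; exact Subtype.ext hcS₀
      · have hx : 1 < w x := by
          rw [hT, Affine.Point.congrEquiv_some, reducesToZero_some_iff, not_mem_range_iff hv0] at hker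
          exact hker
        obtain ⟨x', y', hxy', hx', hdivpt⟩ := exists_zsmul_eq_of_one_lt_val (w := w)
          (V := (W.localMinimalModel v).baseChange (AlgebraicClosure (v.adicCompletion K)))
          (m := ((ℓ ^ n : ℕ) : ℤ)) (hℓnw n) hxy hx
        set Q₁ : ((W.localMinimalModel v).baseChange (AlgebraicClosure (v.adicCompletion K))).toAffine.Point :=
          .some x' y' hxy' with hQ₁
        have hQ₁E₁ : W₀.ReducesToZero (Affine.Point.congrEquiv hW₀ Q₁) := by
          rw [hQ₁, Affine.Point.congrEquiv_some, reducesToZero_some_iff, not_mem_range_iff hv0]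
          exact hx'
        have hE₀' : W₀.HasNonsingularReduction (Affine.Point.congrEquiv hW₀ (S₀ - Q₁)) := by
          rw [map_sub]
          exact (W₀.nonsingularReductionSubgroup hv0).sub_mem hS₀E₀ hQ₁E₁.hasNonsingularReduction
        have hdivpt' : ((ℓ ^ n : ℕ) : ℤ) • Q₁ = Affine.Point.some x y hxy := by
          rw [hQ₁]; exact hdivpt
        refine ⟨S₀ - Q₁, hE₀', ?_, ?_⟩
        · rw [nsmul_sub, hT, ← natCast_zsmul (Q₁), hdivpt', sub_self]
        · have hsplit : (⟨Affine.Point.congrEquiv hW₀ (S₀ - Q₁), hE₀'⟩ :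
              W₀.nonsingularReductionSubgroup hv0) =
              ⟨Affine.Point.congrEquiv hW₀ S₀, hS₀E₀⟩ -
                ⟨Affine.Point.congrEquiv hW₀ Q₁, hQ₁E₁.hasNonsingularReduction⟩ :=
            Subtype.ext (by
              change Affine.Point.congrEquiv hW₀ (S₀ - Q₁) =
                Affine.Point.congrEquiv hW₀ S₀ - Affine.Point.congrEquiv hW₀ Q₁
              rw [map_sub])
          rw [hsplit, map_sub,
            (hrn ⟨Affine.Point.congrEquiv hW₀ Q₁, hQ₁E₁.hasNonsingularReduction⟩).mpr hQ₁E₁,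
            sub_zero, ← hP₀]
          congr 1; exact Subtype.ext hcS₀
    -- `P₁` comes from `E(K̄)[ℓ^n]`
    obtain ⟨P₂, -, hP₂⟩ := exists_pointsMapOfEmb_eq_of_nsmul_eq_zero W ι (m := ℓ ^ n)
      (pow_ne_zero n (Fact.out : ℓ.Prime).ne_zero) (Q := Φ.symm P₁)
      (by rw [← map_nsmul, hP₁tors, map_zero])
    have hΦP₂ : Φ (pointsMapOfEmb W ι P₂) = P₁ := by rw [hP₂, AddEquiv.apply_symm_apply]
    -- `P₂` is fixed by `I_𝔓`
    have hP₂fix : ∀ σ ∈ H, σ • P₂ = P₂ := by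
      intro σ hσ
      obtain ⟨τ, hτI, hres⟩ := hlift hσ
      obtain ⟨hτ₁, hτ₂⟩ := isometry_of_mem_inertia hw h𝔐 hτI
      apply pointsMapOfEmb_injective W ι
      rw [← hres, pointsMapOfEmb_smul]
      apply Φ.injective
      rw [hΦ τ, hΦP₂]
      have hE₀τ := (W₀.hasNonsingularReduction_congrEquiv_map_iff hW₀
        ((absoluteGaloisGroup.toAlgEquiv _ τ :
            AlgebraicClosure (v.adicCompletion K) ≃ₐ[v.adicCompletion K]
              AlgebraicClosure (v.adicCompletion K)) :
            AlgebraicClosure (v.adicCompletion K) →ₐ[v.adicCompletion K]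
              AlgebraicClosure (v.adicCompletion K)) hτ₁ hτ₂ P₁).mpr hP₁E₀
      have hred := W₀.reducePoint_congrEquiv_map_eq hW₀
        ((absoluteGaloisGroup.toAlgEquiv _ τ :
            AlgebraicClosure (v.adicCompletion K) ≃ₐ[v.adicCompletion K]
              AlgebraicClosure (v.adicCompletion K)) :
            AlgebraicClosure (v.adicCompletion K) →ₐ[v.adicCompletion K]
              AlgebraicClosure (v.adicCompletion K)) hτ₁ hτ₂ P₁
      have key := W₀.eq_of_reducePoint_eq_of_zsmul_eq_zero (hℓnw n) hE₀τ hP₁E₀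
        (by rw [← map_zsmul, ← map_zsmul, natCast_zsmul, hP₁tors, map_zero, map_zero])
        (by rw [← map_zsmul, natCast_zsmul, hP₁tors, map_zero]) hred
      exact (Affine.Point.congrEquiv hW₀).injective key
    have hP₂mem : P₂ ∈ FixedPoints.addSubgroup H (geomPoints W) := fun m ↦ hP₂fix m m.2
    have hFP₂ : F ⟨P₂, hP₂mem⟩ = Affine.Point.congrEquiv hW₀ P₁ := by
      rw [hFapply]; exact congrArg _ hΦP₂
    have hP₂A' : (⟨P₂, hP₂mem⟩ : FixedPoints.addSubgroup H (geomPoints W)) ∈ A' := by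
      rw [hA'mem, hFP₂]; exact hP₁E₀
    refine ⟨⟨_, hP₂A'⟩, ?_⟩
    rw [hrapply, ← hP₁img]
    congr 1
    exact Subtype.ext (by rw [hF'coe]; exact hFP₂)
  exact W.codimFixed_inertia_rationalTate_eq_one_of_reduction' ℓ hℓk h (v.primeBelow ι 𝔐) A' hc
    hA' r hr htf hdiv


/-- **Thm. IV.10.2(a), multiplicative case, from Kodaira–Néron, at every prime `𝔓 ∣ v`**
(transitivity of `Γ_K` on the primes above `v` and `primeBelow_comp`).
[cite: SilvermanATAEC1994, Thm. IV.10.2(a), multiplicative case, and its proof (PDF pp. 358–359)] -/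
theorem codimFixed_inertia_rationalTate_eq_one_of_hasMultiplicativeReductionAt_of_kodairaNeron_at
    [W.IsElliptic]
    (hKN : (W.localMinimalModel v).kodairaNeron_exists_finset_reducesToNonsingular)
    (h : Continuous fun x : absoluteGaloisGroup K × RationalTateModule (geomPoints W) ℓ ↦
      rationalTateRepresentation (absoluteGaloisGroup K) (geomPoints W) ℓ x.1 x.2)
    (hℓ : (ℓ : 𝓞 K) ∉ v.asIdeal) (hmult : W.HasMultiplicativeReductionAt v)
    {𝔓 : Ideal (absIntegers (𝓞 K) K)} (h𝔓 : 𝔓 ∈ v.primesAbove) :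
    (rationalTateGaloisRepOf (geomPoints W) ℓ h).codimFixed (𝔓.inertia (absoluteGaloisGroup K)) =
      1 := by
  obtain ⟨𝔐, h𝔐⟩ := v.localPrimesAbove_nonempty
  obtain ⟨g, hg⟩ := HeightOneSpectrum.exists_smul_eq_of_mem_primesAbove_holds
    (HeightOneSpectrum.primeBelow_mem_primesAbove
      (ι := closureEmb (K := K) (v.adicCompletion K)) h𝔐) h𝔓
  have h1 : 𝔓 = v.primeBelow ((closureEmb (K := K) (v.adicCompletion K)).comp
      ((show AlgebraicClosure K ≃ₐ[K] AlgebraicClosure K from g⁻¹) :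
        AlgebraicClosure K →ₐ[K] AlgebraicClosure K)) 𝔐 := by
    rw [HeightOneSpectrum.primeBelow_comp, ← hg]
    exact congrArg (· • _) (inv_inv g).symm
  rw [h1]
  exact W.codimFixed_inertia_rationalTate_eq_one_of_hasMultiplicativeReductionAt_of_kodairaNeron_primeBelow
    ℓ hKN h hℓ hmult _ h𝔐

/-- **The named fact `codimFixed_inertia_rationalTate_eq_one_of_hasMultiplicativeReductionAt W ℓ`
(Silverman *ATAEC* Thm. IV.10.2(a), multiplicative case) from the Kodaira–Néron finiteness at
every finite place** (*ATAEC* Cor. IV.9.2(d), not proved in the book).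
[cite: SilvermanATAEC1994, Thm. IV.10.2(a), multiplicative case (PDF p. 358), with Cor. IV.9.2(d)] -/
theorem codimFixed_inertia_rationalTate_eq_one_of_hasMultiplicativeReductionAt_of_kodairaNeron
    (hKN : ∀ v : HeightOneSpectrum (𝓞 K),
      (W.localMinimalModel v).kodairaNeron_exists_finset_reducesToNonsingular) :
    W.codimFixed_inertia_rationalTate_eq_one_of_hasMultiplicativeReductionAt ℓ := by
  intro _ h v hℓ hv 𝔓 h𝔓
  exact W.codimFixed_inertia_rationalTate_eq_one_of_hasMultiplicativeReductionAt_of_kodairaNeron_at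
    ℓ (hKN v) h hℓ hv h𝔓

/-- **Silverman *ATAEC* Thm. IV.10.2(a) in full from Kodaira–Néron**: the tame-part fact
`codimFixed_inertia_rationalTate_eq_tameConductorExponent W ℓ` (`codim (V_ℓ E)^{I_𝔓} = ε_v` at
every `v ∤ ℓ`), the good places being theorems (`HasseWeilAbelianConductorProofs`).
[cite: SilvermanATAEC1994, Thm. IV.10.2(a) (PDF p. 358), with Cor. IV.9.2(d)] -/
theorem codimFixed_inertia_rationalTate_eq_tameConductorExponent_of_kodairaNeron
    (hKN : ∀ v : HeightOneSpectrum (𝓞 K),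
      (W.localMinimalModel v).kodairaNeron_exists_finset_reducesToNonsingular) :
    W.codimFixed_inertia_rationalTate_eq_tameConductorExponent ℓ :=
  W.codimFixed_inertia_rationalTate_eq_tameConductorExponent_of_mult_of_add ℓ
    (W.codimFixed_inertia_rationalTate_eq_one_of_hasMultiplicativeReductionAt_of_kodairaNeron ℓ hKN)
    (W.codimFixed_inertia_rationalTate_eq_two_of_hasAdditiveReductionAt_of_kodairaNeron ℓ hKN)

/-- **Silverman *ATAEC* Thm. IV.10.2(b) at the multiplicative places from Kodaira–Néron**
(`Sw_𝔓(V_ℓ E) = 0`: unipotent inertia is tame, `…_of_codim`, `BSDConductorSemistableProofs`).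
[cite: SilvermanATAEC1994, Thm. IV.10.2(b) (PDF p. 358), with Cor. IV.9.2(d)] -/
theorem swanConductorAt_rationalTate_eq_zero_of_hasMultiplicativeReductionAt_of_kodairaNeron
    (hKN : ∀ v : HeightOneSpectrum (𝓞 K),
      (W.localMinimalModel v).kodairaNeron_exists_finset_reducesToNonsingular) :
    W.swanConductorAt_rationalTate_eq_zero_of_hasMultiplicativeReductionAt ℓ :=
  W.swanConductorAt_rationalTate_eq_zero_of_hasMultiplicativeReductionAt_of_codim ℓ
    (W.codimFixed_inertia_rationalTate_eq_one_of_hasMultiplicativeReductionAt_of_kodairaNeron ℓ hKN)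

/-- **The C15 fact for semistable curves from Kodaira–Néron alone**: for a semistable elliptic
`E/K`, `a_v(V_ℓ E) = f_v(E)` at every `v ∤ ℓ` (Silverman *ATAEC* Thm. IV.10.2 and Example 10.5).
[cite: SilvermanATAEC1994, Thm. IV.10.2 and Example 10.5 (PDF pp. 358–364), with Cor. IV.9.2(d)] -/
theorem artinConductorExponent_tate_eq_conductorExponent_of_isSemistable_of_kodairaNeron
    [W.IsElliptic] (hs : W.IsSemistable (𝓞 K))
    (hKN : ∀ v : HeightOneSpectrum (𝓞 K),
      (W.localMinimalModel v).kodairaNeron_exists_finset_reducesToNonsingular)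
    (h : Continuous fun x : absoluteGaloisGroup K × RationalTateModule (geomPoints W) ℓ ↦
      rationalTateRepresentation (absoluteGaloisGroup K) (geomPoints W) ℓ x.1 x.2)
    (v : HeightOneSpectrum (𝓞 K)) (hℓ : (ℓ : 𝓞 K) ∉ v.asIdeal) :
    conductorExponentOf (geomPoints W) ℓ h v = W.conductorExponent v :=
  W.artinConductorExponent_tate_eq_conductorExponent_of_isSemistable_of_codim ℓ hs
    (W.codimFixed_inertia_rationalTate_eq_one_of_hasMultiplicativeReductionAt_of_kodairaNeron ℓ hKN)
    h v hℓ


end WeierstrassCurve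

/-! ### Over `ℚ`: bsd.S15 from Kodaira–Néron (and Ogg–Saito at `2, 3`) -/

namespace Literature.NumberTheory.EllipticCurves

open WeierstrassCurve IsDedekindDomain

variable (W : WeierstrassCurve ℚ) (ℓ : ℕ) [Fact ℓ.Prime]

/-- **bsd.S15 for a semistable elliptic `E/ℚ` from the Kodaira–Néron finiteness alone.**  The
schema `conductorNorm_eq_artinConductorNat W ℓ` (`N_E = N^{(ℓ)}(V_ℓ E)` for `ℓ ∤ N_E`) at a
semistable elliptic `W`, from Kodaira–Néron for the minimal models of `W` at the finite places
(Silverman *ATAEC* Cor. IV.9.2(d)), via `conductorNorm_eq_artinConductorNat_of_isSemistable_of_codim`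
(`BSDConductorSchemaProofs`).
[cite: SilvermanATAEC1994, §IV.10 Definition of the conductor (PDF p. 364) with Thm. IV.10.2, Example 10.5 and Cor. IV.9.2(d)] -/
theorem conductorNorm_eq_artinConductorNat_of_isSemistable_of_kodairaNeron [W.IsElliptic]
    (hs : W.IsSemistable (𝓞 ℚ))
    (hKN : ∀ v : HeightOneSpectrum (𝓞 ℚ),
      (W.localMinimalModel v).kodairaNeron_exists_finset_reducesToNonsingular) :
    conductorNorm_eq_artinConductorNat W ℓ :=
  conductorNorm_eq_artinConductorNat_of_isSemistable_of_codim W ℓ hs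
    (W.codimFixed_inertia_rationalTate_eq_one_of_hasMultiplicativeReductionAt_of_kodairaNeron ℓ hKN)

/-- **bsd.S15 for an elliptic `E/ℚ` from Kodaira–Néron (for the elliptic curves over `ℚ`) and
the Ogg–Saito formula in residue characteristics `2, 3` only** — the two inputs of Silverman's
Chapter IV that the book does not prove (Cor. IV.9.2(d); 11.1 at `p = 2` via Saito).  Via
`conductorNorm_eq_artinConductorNat_of_codim_of_ringChar_eq` (`HasseWeilAbelianTameNegativeJProofs`):
Thm. IV.10.2(a) for the curves over `ℚ` and 10.2(b), clause `p ≥ 5`, are theorems given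
Kodaira–Néron.
[cite: SilvermanATAEC1994, §IV.10 Definition of the conductor (PDF p. 364) with Thm. IV.10.2, proof of Thm. IV.11.1 (p. 366) and Cor. IV.9.2(d)] -/
theorem conductorNorm_eq_artinConductorNat_of_kodairaNeron_of_ringChar_eq [W.IsElliptic]
    (hKN : ∀ (X : WeierstrassCurve ℚ) (v : HeightOneSpectrum (𝓞 ℚ)),
      (X.localMinimalModel v).kodairaNeron_exists_finset_reducesToNonsingular)
    (hW23 : W.swanConductorAt_rationalTate_eq_wildConductorExponent_of_ringChar_eq ℓ) :
    conductorNorm_eq_artinConductorNat W ℓ :=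
  conductorNorm_eq_artinConductorNat_of_codim_of_ringChar_eq W ℓ
    (fun X ↦ X.codimFixed_inertia_rationalTate_eq_one_of_hasMultiplicativeReductionAt_of_kodairaNeron
      ℓ (hKN X))
    (W.codimFixed_inertia_rationalTate_eq_two_of_hasAdditiveReductionAt_of_kodairaNeron ℓ (hKN W))
    hW23

end Literature.NumberTheory.EllipticCurves

end
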